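import Summits.AtomisticToContinuum.BoseEinsteinCondensation.Theorems.BECGroundStateSOSPeriodicIRBoundFsumDefs
import Summits.AtomisticToContinuum.BoseEinsteinCondensation.Theorems.BECGroundStateSOSPeriodicIRBoundFsumDCKinetic
import Summits.AtomisticToContinuum.BoseEinsteinCondensation.Theorems.BECGroundStateSOSPeriodicIRBoundFsumDCAdjoint
import Summits.AtomisticToContinuum.BoseEinsteinCondensation.Theorems.BECGroundStateSOSPeriodicIRBoundFsumDCPotPairs
import Summits.AtomisticToContinuum.BoseEinsteinCondensation.Theorems.BECGroundStateSOSPeriodicIRBoundWFKinematics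
import Summits.AtomisticToContinuum.BoseEinsteinCondensation.Theorems.BECConjugateDominationIMUChainGlueEnergy
import Literature.MathematicalPhysics.QuantumManyBody.PeriodicBoseGasFracEnergy
import HarnessLib

/-!
# Crux `PeriodicIRBound` (stmt-AtomisticToContinuum-3972), line `fsum-phase-pencil`, stub S5-D2
# `stub_fsumDichotomy` — the condensate dichotomy for near-minimisers of every class potential

For every potential class `𝒱(R₀, V₁)` carrying the no-cat input `CondensateNumberVarianceClass R₀ V₁`
(`‖n̂₀Ψ‖² ≤ ⟨Ψ, n̂₀Ψ⟩² + C_V N`) and the weighted class bound `WeightedClassBound R₀ V₁`, and given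

* (E1) the excited-pair mass identity `∑_q ‖a_q a_0 Ψ‖² = (N − 1) ‖a_0 Ψ‖²`,
* (E2) the ultraviolet tail bound `∑_{‖q‖_∞ > K} ‖a_q a_0 Ψ‖² ≤ (N − 1) (L²/4π²K²) 𝓔_w[Ψ]`,
* (D1) the weighted window sum `∑_{0 < ‖q‖_∞ ≤ κ'√ρ L} ‖T_{q0} Ψ‖² ≤ 13 C κ'² √ρ N²`,

every near-minimiser (slack after `N`) has `n̄₀ ≤ 0.15 N` or `n̄₀ ≥ 0.85 N`, for `ρ < ρ₁(R₀, V₁)`, eventually in `N`.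

Proof at fixed `(N, L)`, `N = n + 2`, `x = ‖a_0Ψ‖² = n̄₀`, `S₀ = ‖a_0 a_0 Ψ‖²`: split (E1) into the `q = 0` term, the
window and the tail; the window terms are `≤ ‖T_{q0}Ψ‖²` (`‖T_{ab}Ψ‖² = n_b + ‖a_a a_b Ψ‖²`), so (D1) with
`13 C κ'² √ρ ≤ 1/20` bounds the window by `N²/20`; (E2) with `K = κ'√ρ L`, `κ'² = 1 + 3V₁`, the Hartree bound
`E₀ ≤ C(N,2) ‖w‖₁/L³ ≤ ½ N ρ V₁` and `δ ≤ ρ` bounds the tail by `N²/100`; no-cat reads `x + S₀ ≤ x² + C_V N`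
(`‖T_{00}Ψ‖² = x + S₀`, `⟨Ψ, T_{00}Ψ⟩ = x`). Hence `x (N − x) ≤ C_V N + N²/20 + N²/100 < 0.1275 N²` once
`N ≥ 40 max(1, C_V)`, i.e. `(x − 0.15N)(0.85N − x) < 0`.
-/

noncomputable section

open MeasureTheory Filter
open scoped ENNReal NNReal ComplexConjugate BigOperators

namespace Summit.AtomisticToContinuum.BoseEinsteinCondensation.Cruxes.PeriodicIRBound.FsumPhasePencil

open Literature.MathematicalPhysics.QuantumManyBody.BoseGas
open Summit.AtomisticToContinuum.BoseEinsteinCondensation.Theorems.PeriodicIRBound.Negative (NearMin)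
open Summit.AtomisticToContinuum.BoseEinsteinCondensation.Theorems.IMUChainGlue (periodicGroundStateEnergy_le_pairs)
open Summit.AtomisticToContinuum.BoseEinsteinCondensation.Cruxes.PeriodicIRBound.LinearPhFloorWagner.WF

variable {n : ℕ} {L : ℝ}

/-! ## Real bookkeeping -/

/-- The dichotomy algebra: `(n+1) x ≤ S + A + T`, `x + S ≤ x² + C_V (n+2)`, `A ≤ N²/20`, `T ≤ N²/100`,
`40 C_V ≤ N`, `40 ≤ N` (`N = n + 2`) force `x ∉ (0.15 N, 0.85 N)`. [folklore] -/
theorem dichotomy_algebra {m x S A T CV : ℝ} (hm : 40 ≤ m + 2) (hCV : 40 * CV ≤ m + 2)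
    (hmain : (m + 1) * x ≤ S + A + T) (hcat : x + S ≤ x ^ 2 + CV * (m + 2)) (hA : A ≤ (m + 2) ^ 2 / 20)
    (hT : T ≤ (m + 2) ^ 2 / 100) : x ≤ 3 / 20 * (m + 2) ∨ 17 / 20 * (m + 2) ≤ x := by
  rcases le_or_gt x (3 / 20 * (m + 2)) with h1 | h1
  · exact Or.inl h1
  rcases le_or_gt (17 / 20 * (m + 2)) x with h2 | h2
  · exact Or.inr h2
  exfalso
  have hN0 : (0 : ℝ) ≤ m + 2 := by linarith
  have hCVN : 40 * CV * (m + 2) ≤ (m + 2) * (m + 2) := mul_le_mul_of_nonneg_right hCV hN0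
  nlinarith [mul_pos (sub_pos.2 h1) (sub_pos.2 h2)]

/-- The tail bookkeeping: with `L³ = N/ρ`, `‖w‖₁ ≤ V₁`, `E₀ ≤ C(N,2) ‖w‖₁/L³`, `δ ≤ ρ` and
`t · 4π²(1 + 3V₁)ρ = 1` (`t = L²/(4π²K²)`, `K = κ'√ρ L`, `κ'² = 1 + 3V₁`), the tail
`(N−1) t (E₀ + δ) ≤ N²/100` (`N = n + 2 ≥ 40`, `π² > 9`). [folklore] -/
theorem tail_algebra {m V₁ ρ W L t E d : ℝ} (hm : 40 ≤ m + 2) (hV₁ : 0 ≤ V₁) (hρ : 0 < ρ) (hW : W ≤ V₁)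
    (hL3 : L ^ 3 = (m + 2) / ρ) (ht : t * (4 * Real.pi ^ 2 * (1 + 3 * V₁) * ρ) = 1) (ht0 : 0 ≤ t)
    (hE : E ≤ (m + 2) * (m + 1) / 2 * (W / L ^ 3)) (hd : d ≤ ρ) :
    (m + 1) * t * (E + d) ≤ (m + 2) ^ 2 / 100 := by
  have hm2 : (0 : ℝ) < m + 2 := by linarith
  have hm1 : (0 : ℝ) ≤ m + 1 := by linarith
  have hWL : W / L ^ 3 = W * ρ / (m + 2) := by
    rw [hL3]
    field_simp
  have hE' : E ≤ (m + 1) / 2 * (W * ρ) := by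
    rw [hWL] at hE
    calc E ≤ (m + 2) * (m + 1) / 2 * (W * ρ / (m + 2)) := hE
      _ = (m + 1) / 2 * (W * ρ) := by field_simp
  have hEd : E + d ≤ ρ * ((m + 1) / 2 * V₁ + 1) := by
    nlinarith [mul_le_mul_of_nonneg_right hW hρ.le]
  have hQ : 0 < 4 * Real.pi ^ 2 * (1 + 3 * V₁) := by positivity
  have hpi : (9 : ℝ) < Real.pi ^ 2 := by nlinarith [Real.pi_gt_three]
  -- `u = t ρ = 1 / (4π²(1 + 3V₁))`
  have hu : t * ρ = 1 / (4 * Real.pi ^ 2 * (1 + 3 * V₁)) := by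
    rw [eq_div_iff hQ.ne']
    linarith [ht]
  have step : (m + 1) * t * (E + d) ≤ (m + 1) * ((m + 1) / 2 * V₁ + 1) * (t * ρ) := by
    have := mul_le_mul_of_nonneg_left hEd (mul_nonneg hm1 ht0)
    nlinarith [this]
  refine step.trans ?_
  rw [hu, ← mul_div_assoc, mul_one, div_le_iff₀ hQ]
  nlinarith [mul_nonneg hV₁ (sq_nonneg (m + 1)), mul_nonneg hV₁ hm2.le, sq_nonneg (m + 2),
    mul_le_mul_of_nonneg_right hpi.le (mul_nonneg (sq_nonneg (m + 2)) (by linarith : (0 : ℝ) ≤ 1 + 3 * V₁))]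

/-- The window bookkeeping: `ρ < (1/(260 C κ'²))²` gives `13 C κ'² √ρ N² ≤ N²/20`. [folklore] -/
theorem window_algebra {C k2 ρ N : ℝ} (hC : 0 < C) (hk2 : 0 < k2) (hρ : 0 < ρ)
    (hρc : ρ < (1 / (260 * C * k2)) ^ 2) : 13 * C * k2 * Real.sqrt ρ * N ^ 2 ≤ N ^ 2 / 20 := by
  have hpos : 0 < 1 / (260 * C * k2) := by positivity
  have hs : Real.sqrt ρ < 1 / (260 * C * k2) := by
    have := Real.sqrt_lt_sqrt hρ.le hρc
    rwa [Real.sqrt_sq hpos.le] at this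
  have h13 : 13 * C * k2 * Real.sqrt ρ ≤ 1 / 20 := by
    have h := (mul_lt_mul_of_pos_left hs (by positivity : (0 : ℝ) < 13 * C * k2)).le
    calc 13 * C * k2 * Real.sqrt ρ ≤ 13 * C * k2 * (1 / (260 * C * k2)) := h
      _ = 1 / 20 := by field_simp; ring
  nlinarith [sq_nonneg N]

/-! ## The Hartree bound in reals at particle number `n + 2` (`cast_choose_two_add_two` of the pair reduction) -/

/-- **Hartree bound** (constant trial state): `E₀(n+2, L) < ∞` and `E₀(n+2, L) ≤ C(n+2, 2) · ‖w‖₁ / L³` as real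
numbers, for measurable `w` with `‖w‖₁ < ∞`. [folklore] -/
theorem groundStateEnergy_two_le_pairs {w : ℝ → ℝ≥0∞} (hL : 0 < L) (hw : Measurable w)
    (hint : (∫⁻ z : Space, w ‖z‖) ≠ ⊤) (n : ℕ) :
    periodicGroundStateEnergy w (n + 2) L ≠ ⊤ ∧
      (periodicGroundStateEnergy w (n + 2) L).toReal ≤
        ((n + 2) * (n + 1) / 2 : ℝ) * ((∫⁻ z : Space, w ‖z‖).toReal / L ^ 3) := by
  have h : periodicGroundStateEnergy w (n + 2) L ≤
      (((n + 2).choose 2 : ℕ) : ℝ≥0∞) * ((ENNReal.ofReal L ^ 3)⁻¹ * ∫⁻ z : Space, w ‖z‖) :=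
    periodicGroundStateEnergy_le_pairs hL hw n
  have hL3 : (ENNReal.ofReal L ^ 3)⁻¹ ≠ ⊤ := ENNReal.inv_ne_top.2 (pow_ne_zero _ (ENNReal.ofReal_pos.2 hL).ne')
  have hne : (((n + 2).choose 2 : ℕ) : ℝ≥0∞) * ((ENNReal.ofReal L ^ 3)⁻¹ * ∫⁻ z : Space, w ‖z‖) ≠ ⊤ :=
    ENNReal.mul_ne_top (ENNReal.natCast_ne_top _) (ENNReal.mul_ne_top hL3 hint)
  refine ⟨ne_top_of_le_ne_top hne h, ?_⟩
  have h' := ENNReal.toReal_mono hne h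
  rw [ENNReal.toReal_mul, ENNReal.toReal_mul, ENNReal.toReal_natCast, ENNReal.toReal_inv, ENNReal.toReal_pow,
    ENNReal.toReal_ofReal hL.le, cast_choose_two_add_two] at h'
  calc (periodicGroundStateEnergy w (n + 2) L).toReal ≤ _ := h'
    _ = _ := by ring

/-! ## Fixed `(N, L)`: splitting the excited-pair mass and the core inequality -/

/-- Splitting an `ℝ≥0∞` series over `ℤ³` into the `q = 0` term, the window `0 < ‖q‖_∞ ≤ K` and the tail
`‖q‖_∞ > K` (`K ≥ 0`). [folklore] -/
theorem tsum_split_window (P : (Fin 3 → ℤ) → ℝ≥0∞) {K : ℝ} (hK : 0 ≤ K) :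
    ∑' q, P q = P 0 + (∑' q : Fin 3 → ℤ, if q ≠ 0 ∧ ‖(fun j => (q j : ℝ))‖ ≤ K then P q else 0) +
      ∑' q : Fin 3 → ℤ, if K < ‖(fun j => (q j : ℝ))‖ then P q else 0 := by
  have hpt : ∀ q : Fin 3 → ℤ, P q = (if q = 0 then P q else 0) +
      (if q ≠ 0 ∧ ‖(fun j => (q j : ℝ))‖ ≤ K then P q else 0) +
        (if K < ‖(fun j => (q j : ℝ))‖ then P q else 0) := by
    intro q
    by_cases hq : q = 0
    · subst hq
      have h0 : (fun j => ((0 : Fin 3 → ℤ) j : ℝ)) = 0 := by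
        funext j
        simp
      rw [h0, norm_zero]
      simp [hK, not_lt.2 hK]
    · by_cases hle : ‖(fun j => (q j : ℝ))‖ ≤ K
      · simp [hq, hle, not_lt.2 hle]
      · simp [hq, hle, lt_of_not_ge hle]
  rw [tsum_congr hpt, ENNReal.tsum_add, ENNReal.tsum_add, tsum_ite_eq]

/-- `‖a_q a_0 Ψ‖² ≤ ‖T_{q0} Ψ‖²` for a core `(n+2)`-body `Ψ` (`‖T_{q0}Ψ‖² = n_0(Ψ) + ‖a_q a_0 Ψ‖²`). [folklore] -/
theorem normSq_modeAn_modeAn_le_transfer (hL : 0 < L) (q : Fin 3 → ℤ) {Ψ : Config (n + 2) → ℂ}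
    (hΨ : IsCore L Ψ) :
    normSq L (modeAn L (planeWaveMode L q) (modeAn L (planeWaveMode L 0) Ψ)) ≤ normSq L (transfer L q 0 Ψ) := by
  have hc : Continuous Ψ := hΨ.contDiff.continuous
  have h1 : normSq L (transfer L q 0 Ψ) ≠ ⊤ := normSq_ne_top L (continuous_transfer L q 0 hc)
  have h2 : normSq L (modeAn L (planeWaveMode L q) (modeAn L (planeWaveMode L 0) Ψ)) ≠ ⊤ :=
    normSq_ne_top L (continuous_modeAn L (continuous_planeWaveMode L q)
      (continuous_modeAn L (continuous_planeWaveMode L 0) hc))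
  rw [← ENNReal.toReal_le_toReal h2 h1, toReal_normSq_transfer hL q 0 hΨ]
  exact le_add_of_nonneg_left ENNReal.toReal_nonneg

/-- **The core inequality at fixed `(N, L)`** (`N = n + 2`, as real numbers): from (E1), (E2) at threshold `K` with
tail factor `T`, the window bound `A` and the near-minimiser property with slack `δ`,
`(n+1) ‖a_0Ψ‖² ≤ ‖a_0 a_0 Ψ‖² + A + (n+1) T (E₀ + δ)`. [folklore] -/
theorem core_ineq (hL : 0 < L) (w : ℝ → ℝ≥0∞) (Ψ : PeriodicTrialState (n + 2) L) {K A : ℝ} (hK : 0 < K)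
    (hA : 0 ≤ A) {T δ : ℝ≥0∞} (hT : T ≠ ⊤) (hδ : δ ≠ ⊤) (hE : periodicGroundStateEnergy w (n + 2) L ≠ ⊤)
    (hnear : periodicEnergy w Ψ ≤ periodicGroundStateEnergy w (n + 2) L + δ)
    (h1 : ∑' q : Fin 3 → ℤ, normSq L (modeAn L (planeWaveMode L q) (modeAn L (planeWaveMode L 0) Ψ.ψ)) =
      (n + 1 : ℝ≥0∞) * normSq L (modeAn L (planeWaveMode L 0) Ψ.ψ))
    (h2 : ∑' q : Fin 3 → ℤ, (if K < ‖(fun j => (q j : ℝ))‖ then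
        normSq L (modeAn L (planeWaveMode L q) (modeAn L (planeWaveMode L 0) Ψ.ψ)) else 0) ≤
      (n + 1 : ℝ≥0∞) * T * periodicEnergy w Ψ)
    (hwin : (∑' q : Fin 3 → ℤ, if q ≠ 0 ∧ ‖(fun j => (q j : ℝ))‖ ≤ K then
        normSq L (transfer L q 0 Ψ.ψ) else 0) ≤ ENNReal.ofReal A) :
    (n + 1 : ℝ) * (normSq L (modeAn L (planeWaveMode L 0) Ψ.ψ)).toReal ≤
      (normSq L (modeAn L (planeWaveMode L 0) (modeAn L (planeWaveMode L 0) Ψ.ψ))).toReal + A +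
        (n + 1 : ℝ) * T.toReal * ((periodicGroundStateEnergy w (n + 2) L).toReal + δ.toReal) := by
  have hcore : IsCore L Ψ.ψ := isCore_trialState Ψ
  have hc : Continuous Ψ.ψ := hcore.contDiff.continuous
  have hsplit := tsum_split_window
    (fun q => normSq L (modeAn L (planeWaveMode L q) (modeAn L (planeWaveMode L 0) Ψ.ψ))) hK.le
  -- the window
  have hW : (∑' q : Fin 3 → ℤ, if q ≠ 0 ∧ ‖(fun j => (q j : ℝ))‖ ≤ K then
      normSq L (modeAn L (planeWaveMode L q) (modeAn L (planeWaveMode L 0) Ψ.ψ)) else 0) ≤ ENNReal.ofReal A := by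
    refine le_trans (ENNReal.tsum_le_tsum fun q => ?_) hwin
    split_ifs
    · exact normSq_modeAn_modeAn_le_transfer hL q hcore
    · exact le_rfl
  -- the tail
  have hTl : (∑' q : Fin 3 → ℤ, if K < ‖(fun j => (q j : ℝ))‖ then
      normSq L (modeAn L (planeWaveMode L q) (modeAn L (planeWaveMode L 0) Ψ.ψ)) else 0) ≤
      (n + 1 : ℝ≥0∞) * T * (periodicGroundStateEnergy w (n + 2) L + δ) :=
    h2.trans (by gcongr)
  have hmain : (n + 1 : ℝ≥0∞) * normSq L (modeAn L (planeWaveMode L 0) Ψ.ψ) ≤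
      normSq L (modeAn L (planeWaveMode L 0) (modeAn L (planeWaveMode L 0) Ψ.ψ)) + ENNReal.ofReal A +
        (n + 1 : ℝ≥0∞) * T * (periodicGroundStateEnergy w (n + 2) L + δ) := by
    rw [← h1, hsplit]
    exact add_le_add (add_le_add le_rfl hW) hTl
  -- to the reals
  have hP0 : normSq L (modeAn L (planeWaveMode L 0) (modeAn L (planeWaveMode L 0) Ψ.ψ)) ≠ ⊤ :=
    normSq_ne_top L (continuous_modeAn L (continuous_planeWaveMode L 0)
      (continuous_modeAn L (continuous_planeWaveMode L 0) hc))
  have hn1 : (n + 1 : ℝ≥0∞) ≠ ⊤ := ENNReal.add_ne_top.2 ⟨ENNReal.natCast_ne_top n, ENNReal.one_ne_top⟩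
  have hEδ : periodicGroundStateEnergy w (n + 2) L + δ ≠ ⊤ := ENNReal.add_ne_top.2 ⟨hE, hδ⟩
  have hlast : (n + 1 : ℝ≥0∞) * T * (periodicGroundStateEnergy w (n + 2) L + δ) ≠ ⊤ :=
    ENNReal.mul_ne_top (ENNReal.mul_ne_top hn1 hT) hEδ
  have hPA : normSq L (modeAn L (planeWaveMode L 0) (modeAn L (planeWaveMode L 0) Ψ.ψ)) + ENNReal.ofReal A ≠ ⊤ :=
    ENNReal.add_ne_top.2 ⟨hP0, ENNReal.ofReal_ne_top⟩
  have h := ENNReal.toReal_mono (ENNReal.add_ne_top.2 ⟨hPA, hlast⟩) hmain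
  rw [ENNReal.toReal_mul, ENNReal.toReal_add hPA hlast, ENNReal.toReal_add hP0 ENNReal.ofReal_ne_top,
    ENNReal.toReal_ofReal hA, ENNReal.toReal_mul, ENNReal.toReal_mul, ENNReal.toReal_add hE hδ] at h
  have hn : ((n : ℝ≥0∞) + 1).toReal = (n : ℝ) + 1 := by
    rw [ENNReal.toReal_add (ENNReal.natCast_ne_top n) ENNReal.one_ne_top, ENNReal.toReal_natCast,
      ENNReal.toReal_one]
  rw [hn] at h
  exact h

/-- **No-cat in occupation variables** (`N = n + 2`): `‖T_{00}Ψ‖² = ‖a_0Ψ‖² + ‖a_0 a_0 Ψ‖²` and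
`Re⟨Ψ, T_{00}Ψ⟩ = ‖a_0Ψ‖²`. [folklore] -/
theorem nocat_dictionary (hL : 0 < L) (Ψ : PeriodicTrialState (n + 2) L) :
    (normSq L (transfer L 0 0 Ψ.ψ)).toReal = (normSq L (modeAn L (planeWaveMode L 0) Ψ.ψ)).toReal +
        (normSq L (modeAn L (planeWaveMode L 0) (modeAn L (planeWaveMode L 0) Ψ.ψ))).toReal ∧
      innerRe L Ψ.ψ (transfer L 0 0 Ψ.ψ) = (normSq L (modeAn L (planeWaveMode L 0) Ψ.ψ)).toReal := by
  have hcore : IsCore L Ψ.ψ := isCore_trialState Ψ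
  have hc : Continuous Ψ.ψ := hcore.contDiff.continuous
  refine ⟨toReal_normSq_transfer hL 0 0 hcore, ?_⟩
  rw [← innerRe_modeAn_modeAn 0 0 hc hcore.symm hc,
    innerRe_self (continuous_modeAn L (continuous_planeWaveMode L 0) hc)]

/-- `n̄₀ = ‖a_0 Ψ‖²` (`condensateOccupation = cellOccupation` of the zero mode `= normSq ∘ modeAn`). [folklore] -/
theorem condensateOccupation_eq_normSq_modeAn (hL : 0 < L) (Ψ : Config (n + 1) → ℂ) :
    condensateOccupation (n + 1) L Ψ = normSq L (modeAn L (planeWaveMode L 0) Ψ) := by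
  rw [normSq_modeAn hL 0 Ψ, cellOccupation_planeWaveMode_zero]

/-! ## The dichotomy, uniformly over a potential class -/

/-- **The condensate dichotomy for near-minimisers of every class potential** (S5-D2): given the excited-pair mass
identity (E1), its ultraviolet tail bound (E2) and the weighted window sum (D1), the no-cat input
`CondensateNumberVarianceClass R₀ V₁` and the weighted class bound give `ρ₁ > 0` such that for `ρ < ρ₁`, eventually
in `N`, every class potential `w` admits a slack `δ > 0` with `n̄₀(Ψ) ≤ 0.15 N ∨ n̄₀(Ψ) ≥ 0.85 N` for all
`δ`-near-minimisers `Ψ` (choices: `κ'² = 1 + 3V₁`, `ρ₁ = min(ρ_v, ρ_w, (260 C κ'²)⁻²)`, `N ≥ 40 max(1, C_V)`,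
`δ = min(δ_v, δ_w, ρ)`). [folklore] -/
theorem dichotomy_of_inputs
    (hE1 : ∀ {n : ℕ} {L : ℝ}, 0 < L → ∀ (Ψ : PeriodicTrialState (n + 2) L),
      ∑' q : Fin 3 → ℤ, normSq L (modeAn L (planeWaveMode L q) (modeAn L (planeWaveMode L 0) Ψ.ψ)) =
        (n + 1 : ℝ≥0∞) * normSq L (modeAn L (planeWaveMode L 0) Ψ.ψ))
    (hE2 : ∀ {n : ℕ} {L : ℝ}, 0 < L → ∀ (w : ℝ → ℝ≥0∞) (Ψ : PeriodicTrialState (n + 2) L) (K : ℝ), 0 < K →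
      ∑' q : Fin 3 → ℤ, (if K < ‖(fun j => (q j : ℝ))‖ then
          normSq L (modeAn L (planeWaveMode L q) (modeAn L (planeWaveMode L 0) Ψ.ψ)) else 0) ≤
        (n + 1 : ℝ≥0∞) * ENNReal.ofReal (L ^ 2 / (4 * Real.pi ^ 2 * K ^ 2)) * periodicEnergy w Ψ)
    (hD1 : ∀ R₀ V₁ : ℝ, 0 < R₀ → 0 ≤ V₁ → WeightedClassBound R₀ V₁ → ∀ κ' : ℝ, 0 < κ' → ∃ ρ₀ : ℝ, 0 < ρ₀ ∧
      ∃ C : ℝ, 0 < C ∧ ∀ ρ : ℝ, 0 < ρ → ρ < ρ₀ → ∀ᶠ N : ℕ in atTop, ∀ w : ℝ → ℝ≥0∞, InClass R₀ V₁ w →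
        periodicGroundStateEnergy w N (sideLength ρ N) ≠ ⊤ → ∃ δ : ℝ≥0∞, 0 < δ ∧
          ∀ Ψ : PeriodicTrialState N (sideLength ρ N), NearMin w ρ N δ Ψ →
            (∑' q : Fin 3 → ℤ, if q ≠ 0 ∧ ‖(fun j => (q j : ℝ))‖ ≤ κ' * Real.sqrt ρ * sideLength ρ N then
                normSq (sideLength ρ N) (transfer (sideLength ρ N) q 0 Ψ.ψ) else 0) ≤
              ENNReal.ofReal (13 * C * κ' ^ 2 * Real.sqrt ρ * (N : ℝ) ^ 2))
    {R₀ V₁ : ℝ} (hR₀ : 0 < R₀) (hV₁ : 0 ≤ V₁) (hNC : CondensateNumberVarianceClass R₀ V₁)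
    (hWB : WeightedClassBound R₀ V₁) :
    ∃ ρ₁ : ℝ, 0 < ρ₁ ∧ ∀ ρ : ℝ, 0 < ρ → ρ < ρ₁ → ∀ᶠ N : ℕ in atTop, ∀ w : ℝ → ℝ≥0∞, InClass R₀ V₁ w →
      ∃ δ : ℝ≥0∞, 0 < δ ∧ ∀ Ψ : PeriodicTrialState N (sideLength ρ N), NearMin w ρ N δ Ψ →
        (condensateOccupation N (sideLength ρ N) Ψ.ψ).toReal ≤ 3 / 20 * N ∨
          17 / 20 * N ≤ (condensateOccupation N (sideLength ρ N) Ψ.ψ).toReal := by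
  obtain ⟨ρv, hρv, CV, hCV, HV⟩ := hNC
  have hk2 : (0 : ℝ) < 1 + 3 * V₁ := by linarith
  obtain ⟨κ', hκ', hκ2⟩ : ∃ κ' : ℝ, 0 < κ' ∧ κ' ^ 2 = 1 + 3 * V₁ :=
    ⟨Real.sqrt (1 + 3 * V₁), Real.sqrt_pos.2 hk2, Real.sq_sqrt hk2.le⟩
  obtain ⟨ρw, hρw, C, hC, HW⟩ := hD1 R₀ V₁ hR₀ hV₁ hWB κ' hκ'
  have hρc : (0 : ℝ) < (1 / (260 * C * κ' ^ 2)) ^ 2 := by positivity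
  refine ⟨min ρv (min ρw ((1 / (260 * C * κ' ^ 2)) ^ 2)), lt_min hρv (lt_min hρw hρc), fun ρ hρ hρlt => ?_⟩
  have hρ1 : ρ < ρv := hρlt.trans_le (min_le_left _ _)
  have hρ2 : ρ < ρw := hρlt.trans_le ((min_le_right _ _).trans (min_le_left _ _))
  have hρ3 : ρ < (1 / (260 * C * κ' ^ 2)) ^ 2 := hρlt.trans_le ((min_le_right _ _).trans (min_le_right _ _))
  filter_upwards [HV ρ hρ hρ1, HW ρ hρ hρ2, eventually_ge_atTop 40, eventually_ge_atTop ⌈40 * CV⌉₊] with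
    N HN1 HN2 hN40 hNCV
  intro w hw
  obtain ⟨n, rfl⟩ : ∃ n, N = n + 2 := ⟨N - 2, by omega⟩
  set L : ℝ := sideLength ρ (n + 2) with hLdef
  have hL : 0 < L := sideLength_pos_of_pos hρ (by omega)
  have hint : (∫⁻ x : Space, w ‖x‖) ≠ ⊤ := ne_top_of_le_ne_top ENNReal.ofReal_ne_top hw.2.2
  obtain ⟨hE, hE₀⟩ := groundStateEnergy_two_le_pairs hL hw.1 hint n
  obtain ⟨δv, hδv, PV⟩ := HN1 w hw hE
  obtain ⟨δw, hδw, PW⟩ := HN2 w hw hE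
  refine ⟨min δv (min δw (ENNReal.ofReal ρ)), lt_min hδv (lt_min hδw (ENNReal.ofReal_pos.2 hρ)),
    fun Ψ hΨ => ?_⟩
  have hΨv : NearMin w ρ (n + 2) δv Ψ := le_trans hΨ (add_le_add le_rfl (min_le_left _ _))
  have hΨw : NearMin w ρ (n + 2) δw Ψ :=
    le_trans hΨ (add_le_add le_rfl ((min_le_right _ _).trans (min_le_left _ _)))
  have hδle : min δv (min δw (ENNReal.ofReal ρ)) ≤ ENNReal.ofReal ρ := (min_le_right _ _).trans (min_le_right _ _)
  have hδtop : min δv (min δw (ENNReal.ofReal ρ)) ≠ ⊤ := ne_top_of_le_ne_top ENNReal.ofReal_ne_top hδle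
  have hδr : (min δv (min δw (ENNReal.ofReal ρ))).toReal ≤ ρ :=
    (ENNReal.toReal_mono ENNReal.ofReal_ne_top hδle).trans_eq (ENNReal.toReal_ofReal hρ.le)
  -- the threshold `K = κ'√ρ L` and the tail factor `t = L²/(4π²K²) = 1/(4π²κ'²ρ)`
  set K : ℝ := κ' * Real.sqrt ρ * L with hKdef
  have hK : 0 < K := by positivity
  have ht0 : 0 ≤ L ^ 2 / (4 * Real.pi ^ 2 * K ^ 2) := by positivity
  have hK2 : K ^ 2 = (1 + 3 * V₁) * ρ * L ^ 2 := by
    rw [hKdef, mul_pow, mul_pow, Real.sq_sqrt hρ.le, hκ2]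
  have ht : L ^ 2 / (4 * Real.pi ^ 2 * K ^ 2) * (4 * Real.pi ^ 2 * (1 + 3 * V₁) * ρ) = 1 := by
    have hπ : Real.pi ≠ 0 := Real.pi_pos.ne'
    have hL0 : L ≠ 0 := hL.ne'
    have hρ0 : ρ ≠ 0 := hρ.ne'
    have hk0 : 1 + 3 * V₁ ≠ 0 := hk2.ne'
    rw [hK2]
    field_simp
  -- the core inequality, no-cat, and the bookkeeping
  have hcore := core_ineq hL w Ψ hK (by positivity) ENNReal.ofReal_ne_top hδtop hE hΨ (hE1 hL Ψ)
    (hE2 hL w Ψ K hK) (PW Ψ hΨw)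
  rw [ENNReal.toReal_ofReal ht0] at hcore
  obtain ⟨hns, hinner⟩ := nocat_dictionary hL Ψ
  have hcat := PV Ψ hΨv
  rw [hns, hinner] at hcat
  have hW : (∫⁻ x : Space, w ‖x‖).toReal ≤ V₁ :=
    (ENNReal.toReal_mono ENNReal.ofReal_ne_top hw.2.2).trans_eq (ENNReal.toReal_ofReal hV₁)
  have hL3 : L ^ 3 = ((n : ℝ) + 2) / ρ := by
    have h := div_sideLength_pow_three hρ (show 0 < n + 2 by omega)
    rw [← hLdef, div_eq_iff (pow_pos hL 3).ne'] at h
    rw [eq_div_iff hρ.ne']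
    push_cast at h
    linarith
  have hn40 : (40 : ℝ) ≤ n + 2 := by exact_mod_cast hN40
  have hnCV : 40 * CV ≤ (n : ℝ) + 2 := by
    have h := Nat.ceil_le.1 hNCV
    push_cast at h
    exact h
  have htail := tail_algebra hn40 hV₁ hρ hW hL3 ht ht0 hE₀ hδr
  have hA := window_algebra (N := (n : ℝ) + 2) hC (by positivity : 0 < κ' ^ 2) hρ hρ3
  rw [condensateOccupation_eq_normSq_modeAn hL Ψ.ψ]
  push_cast at hcat hcore ⊢
  exact dichotomy_algebra hn40 hnCV hcore hcat hA htail

/-! ## Registered headline -/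

/-- **Registered stub `stub_fsumDichotomy`** (line `fsum-phase-pencil`, S5-D2): the condensate dichotomy
`n̄₀ ≤ 0.15 N ∨ n̄₀ ≥ 0.85 N` for near-minimisers of every class potential, from the excited-pair identity and tail
bound (E1, E2), the weighted window sum (D1), no-cat and the weighted class bound. [folklore] -/
theorem stub_fsumDichotomy : (∀ {n : ℕ} {L : ℝ}, 0 < L → ∀ (Ψ : PeriodicTrialState (n + 2) L), ∑' q : Fin 3 → ℤ, normSq L (modeAn L (planeWaveMode L q) (modeAn L (planeWaveMode L 0) Ψ.ψ)) = (n + 1 : ℝ≥0∞) * normSq L (modeAn L (planeWaveMode L 0) Ψ.ψ)) → (∀ {n : ℕ} {L : ℝ}, 0 < L → ∀ (w : ℝ → ℝ≥0∞) (Ψ : PeriodicTrialState (n + 2) L) (K : ℝ), 0 < K → ∑' q : Fin 3 → ℤ, (if K < ‖(fun j => (q j : ℝ))‖ then normSq L (modeAn L (planeWaveMode L q) (modeAn L (planeWaveMode L 0) Ψ.ψ)) else 0) ≤ (n + 1 : ℝ≥0∞) * ENNReal.ofReal (L ^ 2 / (4 * Real.pi ^ 2 * K ^ 2)) * periodicEnergy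 w Ψ) → (∀ R₀ V₁ : ℝ, 0 < R₀ → 0 ≤ V₁ → WeightedClassBound R₀ V₁ → ∀ κ' : ℝ, 0 < κ' → ∃ ρ₀ : ℝ, 0 < ρ₀ ∧ ∃ C : ℝ, 0 < C ∧ ∀ ρ : ℝ, 0 < ρ → ρ < ρ₀ → ∀ᶠ N : ℕ in atTop, ∀ w : ℝ → ℝ≥0∞, InClass R₀ V₁ w → periodicGroundStateEnergy w N (sideLength ρ N) ≠ ⊤ → ∃ δ : ℝ≥0∞, 0 < δ ∧ ∀ Ψ : PeriodicTrialState N (sideLength ρ N), NearMin w ρ N δ Ψ → (∑' q : Fin 3 → ℤ, if q ≠ 0 ∧ ‖(fun j => (q j : ℝ))‖ ≤ κ' * Real.sqrt ρ * sideLength ρ N then normSq (sideLength ρ N) (transfer (sideLength ρ N) q 0 Ψ.ψ) else 0) ≤ ENNReal.ofReal (13 * C * κ' ^ 2 * Real.sqrt ρ * (N : ℝ) ^ 2)) → ∀ R₀ V₁ : ℝ, 0 < R₀ → 0 ≤ V₁ → CondensateNumberVarianceClass R₀ V₁ → WeightedClassBound R₀ V₁ → ∃ ρ₁ : ℝ,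 0 < ρ₁ ∧ ∀ ρ : ℝ, 0 < ρ → ρ < ρ₁ → ∀ᶠ N : ℕ in atTop, ∀ w : ℝ → ℝ≥0∞, InClass R₀ V₁ w → ∃ δ : ℝ≥0∞, 0 < δ ∧ ∀ Ψ : PeriodicTrialState N (sideLength ρ N), NearMin w ρ N δ Ψ → (condensateOccupation N (sideLength ρ N) Ψ.ψ).toReal ≤ 3 / 20 * N ∨ 17 / 20 * N ≤ (condensateOccupation N (sideLength ρ N) Ψ.ψ).toReal :=
  fun hE1 hE2 hD1 _ _ hR₀ hV₁ hNC hWB => dichotomy_of_inputs hE1 hE2 hD1 hR₀ hV₁ hNC hWB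

end Summit.AtomisticToContinuum.BoseEinsteinCondensation.Cruxes.PeriodicIRBound.FsumPhasePencil

end
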